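import Summits.CriticalPhenomena.CardyFormulaZ2.Theorems.CardyBoundaryCoulombGasBoundaryDefectGaussianRStubTransportPathsPart9
import Mathlib.Analysis.Complex.Basic
import Mathlib.Algebra.Order.Floor.Defs

/-!
# Stub `stub_transportPaths` of line `rainbow-monomials-in-excursion-kernels` — Part 13:
# reading continuum charts on the lattice (mesh points in a frame; flat, convex, reflex)
# (crux `CardyBoundaryCoulombGas.BoundaryDefectGaussianR`, stmt-CriticalPhenomena-14132)

(G3) of the design note. The lattice approximation of TRANSPORT is `V = {v : δ v ∈ closure D}`
with the mesh embedding `v ↦ v₁ δ + v₂ δ i`. In the frame of `K : Fin 4`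
(`u = (w - q)(-i)^K`) the mesh point of `v` has `re u = δ ⟨v, dir K⟩ - re (q (-i)^K)` and
`im u = δ ⟨v, dir (K+1)⟩ - im (q (-i)^K)` (`tp_mesh_frame`), so a continuum closure chart near
`q` becomes an integer threshold rule:

* flat (`closure ↔ 0 ≤ im u`): `v ∈ V ↔ ⌈im (q(-i)^K) / δ⌉ ≤ ⟨v, dir (K+1)⟩` (`tp_lattice_flat`),
  and in the relative form of TRANSPORT's flatness clause around a rail point
  (`tp_lattice_flat_rel`, with `tp_mesh_dist_sq` converting lattice radii);
* convex corner (`0 ≤ re u ∧ 0 ≤ im u`): two thresholds (`tp_lattice_convex`);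
* reflex corner (`0 ≤ im u ∨ re u ≤ 0`): `⌈·⌉ ≤ ⟨v, dir (K+1)⟩ ∨ ⟨v, dir K⟩ ≤ ⌊·⌋`
  (`tp_lattice_reflex`);
* `tp_csec_one/two/three` unfold the `(m = 1 → …) ∧ (m = 2 → …) ∧ (m = 3 → …)` packaging of the
  charts of Part 8.
All [folklore].
-/

noncomputable section

namespace Summit.CriticalPhenomena.CardyFormulaZ2.Cruxes.BoundaryDefectGaussianR.RainbowMonomialsInExcursionKernels

open Literature.Probability.LatticeModels Literature.Probability.LatticeModels.CollarLegModel

/-! ### Unpacking the sector predicates -/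

/-- One quadrant. [folklore] -/
theorem tp_csec_one {A B C : Prop} : ((1 = 1 → A) ∧ (1 = 2 → B) ∧ (1 = 3 → C)) ↔ A :=
  ⟨fun h => h.1 rfl, fun h => ⟨fun _ => h, fun h' => absurd h' (by norm_num),
    fun h' => absurd h' (by norm_num)⟩⟩

/-- Two quadrants. [folklore] -/
theorem tp_csec_two {A B C : Prop} : ((2 = 1 → A) ∧ (2 = 2 → B) ∧ (2 = 3 → C)) ↔ B :=
  ⟨fun h => h.2.1 rfl, fun h => ⟨fun h' => absurd h' (by norm_num), fun _ => h,
    fun h' => absurd h' (by norm_num)⟩⟩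

/-- Three quadrants. [folklore] -/
theorem tp_csec_three {A B C : Prop} : ((3 = 1 → A) ∧ (3 = 2 → B) ∧ (3 = 3 → C)) ↔ C :=
  ⟨fun h => h.2.2 rfl, fun h => ⟨fun h' => absurd h' (by norm_num),
    fun h' => absurd h' (by norm_num), fun _ => h⟩⟩

/-! ### Mesh points in a frame -/

/-- **Frame coordinates of a mesh point**: `re (δv · (-i)^K) = δ ⟨v, dir K⟩` and
`im (δv · (-i)^K) = δ ⟨v, dir (K+1)⟩`. [folklore] -/
theorem tp_mesh_frame (K : Fin 4) (δ : ℝ) (v : ℤ × ℤ) :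
    (((v.1 : ℂ) * ((δ : ℝ) : ℂ) + (v.2 : ℂ) * ((δ : ℝ) : ℂ) * Complex.I) *
        (-Complex.I) ^ (K : ℕ)).re = δ * ((v.1 * (dir K).1 + v.2 * (dir K).2 : ℤ) : ℝ) ∧
    (((v.1 : ℂ) * ((δ : ℝ) : ℂ) + (v.2 : ℂ) * ((δ : ℝ) : ℂ) * Complex.I) *
        (-Complex.I) ^ (K : ℕ)).im = δ * ((v.1 * (dir (K + 1)).1 + v.2 * (dir (K + 1)).2 : ℤ) : ℝ) := by
  obtain ⟨x, y⟩ := v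
  fin_cases K <;> simp [tp_dir_val, pow_succ] <;> ring_nf <;> simp

/-- **Distances between mesh points**: `dist (δ v) (δ w)² = δ² ((v₁-w₁)² + (v₂-w₂)²)`.
[folklore] -/
theorem tp_mesh_dist_sq (δ : ℝ) (v w : ℤ × ℤ) :
    dist ((v.1 : ℂ) * ((δ : ℝ) : ℂ) + (v.2 : ℂ) * ((δ : ℝ) : ℂ) * Complex.I)
        ((w.1 : ℂ) * ((δ : ℝ) : ℂ) + (w.2 : ℂ) * ((δ : ℝ) : ℂ) * Complex.I) ^ 2 =
      δ ^ 2 * (((v.1 - w.1) ^ 2 + (v.2 - w.2) ^ 2 : ℤ) : ℝ) := by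
  rw [dist_eq_norm, Complex.sq_norm, Complex.normSq_apply]
  simp
  ring

/-- Mesh points within lattice radius `R'` of `w` are within `δ R'` of its mesh point. [folklore] -/
theorem tp_mesh_dist_le {δ : ℝ} (hδ : 0 ≤ δ) {R' : ℝ} (hR' : 0 ≤ R') (v w : ℤ × ℤ)
    (h : (((v.1 - w.1) ^ 2 + (v.2 - w.2) ^ 2 : ℤ) : ℝ) ≤ R' ^ 2) :
    dist ((v.1 : ℂ) * ((δ : ℝ) : ℂ) + (v.2 : ℂ) * ((δ : ℝ) : ℂ) * Complex.I)
        ((w.1 : ℂ) * ((δ : ℝ) : ℂ) + (w.2 : ℂ) * ((δ : ℝ) : ℂ) * Complex.I) ≤ δ * R' := by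
  have h2 := tp_mesh_dist_sq δ v w
  have h3 : dist ((v.1 : ℂ) * ((δ : ℝ) : ℂ) + (v.2 : ℂ) * ((δ : ℝ) : ℂ) * Complex.I)
      ((w.1 : ℂ) * ((δ : ℝ) : ℂ) + (w.2 : ℂ) * ((δ : ℝ) : ℂ) * Complex.I) ^ 2 ≤ (δ * R') ^ 2 := by
    rw [h2, mul_pow]
    exact mul_le_mul_of_nonneg_left h (sq_nonneg δ)
  exact (pow_le_pow_iff_left₀ dist_nonneg (mul_nonneg hδ hR') two_ne_zero).1 h3

/-! ### Lattice charts -/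

/-- **Flat lattice chart.** If `V = {v : δ v ∈ S}` and, within `R` of `q`, `S` is the closed
half-plane `im ((w - q)(-i)^K) ≥ 0`, then for mesh points within `R` of `q`:
`v ∈ V ↔ ⌈im (q (-i)^K) / δ⌉ ≤ ⟨v, dir (K+1)⟩`. [folklore] -/
theorem tp_lattice_flat {S : Set ℂ} {δ : ℝ} (hδ : 0 < δ) {V : Finset (ℤ × ℤ)}
    (hV : ∀ v : ℤ × ℤ, v ∈ V ↔
      ((v.1 : ℂ) * ((δ : ℝ) : ℂ) + (v.2 : ℂ) * ((δ : ℝ) : ℂ) * Complex.I) ∈ S)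
    (K : Fin 4) {q : ℂ} {R : ℝ}
    (hchart : ∀ w, dist w q < R → (w ∈ S ↔ 0 ≤ ((w - q) * (-Complex.I) ^ (K : ℕ)).im)) :
    ∀ v : ℤ × ℤ, dist ((v.1 : ℂ) * ((δ : ℝ) : ℂ) + (v.2 : ℂ) * ((δ : ℝ) : ℂ) * Complex.I) q < R →
      (v ∈ V ↔ ⌈(q * (-Complex.I) ^ (K : ℕ)).im / δ⌉ ≤ v.1 * (dir (K + 1)).1 + v.2 * (dir (K + 1)).2) := by
  intro v hv
  rw [hV, hchart _ hv, sub_mul, Complex.sub_im, (tp_mesh_frame K δ v).2, sub_nonneg, Int.ceil_le,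
    div_le_iff₀ hδ]
  constructor <;> intro h <;> linarith

/-- **Flat lattice chart, relative form** (the flatness clause of TRANSPORT): with the data of
`tp_lattice_flat`, a lattice point `w₀` on the boundary rail (`⟨w₀, dir (K+1)⟩` equal to the
threshold) whose mesh point is within `R - δ R'` of `q` sees, within lattice radius `R'`,
`v ∈ V ↔ 0 ≤ ⟨v - w₀, dir (K+1)⟩`. [folklore] -/
theorem tp_lattice_flat_rel {S : Set ℂ} {δ : ℝ} (hδ : 0 < δ) {V : Finset (ℤ × ℤ)}
    (hV : ∀ v : ℤ × ℤ, v ∈ V ↔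
      ((v.1 : ℂ) * ((δ : ℝ) : ℂ) + (v.2 : ℂ) * ((δ : ℝ) : ℂ) * Complex.I) ∈ S)
    (K : Fin 4) {q : ℂ} {R R' : ℝ} (hR' : 0 ≤ R')
    (hchart : ∀ w, dist w q < R → (w ∈ S ↔ 0 ≤ ((w - q) * (-Complex.I) ^ (K : ℕ)).im))
    (w₀ : ℤ × ℤ) (hw₀ : w₀.1 * (dir (K + 1)).1 + w₀.2 * (dir (K + 1)).2 =
      ⌈(q * (-Complex.I) ^ (K : ℕ)).im / δ⌉)
    (hnear : dist ((w₀.1 : ℂ) * ((δ : ℝ) : ℂ) + (w₀.2 : ℂ) * ((δ : ℝ) : ℂ) * Complex.I) q +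
      δ * R' < R) :
    ∀ v : ℤ × ℤ, (((v.1 - w₀.1) ^ 2 + (v.2 - w₀.2) ^ 2 : ℤ) : ℝ) ≤ R' ^ 2 →
      (v ∈ V ↔ 0 ≤ (v.1 - w₀.1) * (dir (K + 1)).1 + (v.2 - w₀.2) * (dir (K + 1)).2) := by
  intro v hv
  have hd := tp_mesh_dist_le hδ.le hR' v w₀ hv
  have hvq : dist ((v.1 : ℂ) * ((δ : ℝ) : ℂ) + (v.2 : ℂ) * ((δ : ℝ) : ℂ) * Complex.I) q < R :=
    lt_of_le_of_lt (dist_triangle _ _ _) (by linarith)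
  rw [tp_lattice_flat hδ hV K hchart v hvq, ← hw₀]
  constructor <;> intro h <;> nlinarith

/-- **Convex lattice chart**: `0 ≤ re u ∧ 0 ≤ im u` becomes two thresholds. [folklore] -/
theorem tp_lattice_convex {S : Set ℂ} {δ : ℝ} (hδ : 0 < δ) {V : Finset (ℤ × ℤ)}
    (hV : ∀ v : ℤ × ℤ, v ∈ V ↔
      ((v.1 : ℂ) * ((δ : ℝ) : ℂ) + (v.2 : ℂ) * ((δ : ℝ) : ℂ) * Complex.I) ∈ S)
    (K : Fin 4) {q : ℂ} {R : ℝ}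
    (hchart : ∀ w, dist w q < R → (w ∈ S ↔ 0 ≤ ((w - q) * (-Complex.I) ^ (K : ℕ)).re ∧
      0 ≤ ((w - q) * (-Complex.I) ^ (K : ℕ)).im)) :
    ∀ v : ℤ × ℤ, dist ((v.1 : ℂ) * ((δ : ℝ) : ℂ) + (v.2 : ℂ) * ((δ : ℝ) : ℂ) * Complex.I) q < R →
      (v ∈ V ↔ ⌈(q * (-Complex.I) ^ (K : ℕ)).re / δ⌉ ≤ v.1 * (dir K).1 + v.2 * (dir K).2 ∧
        ⌈(q * (-Complex.I) ^ (K : ℕ)).im / δ⌉ ≤ v.1 * (dir (K + 1)).1 + v.2 * (dir (K + 1)).2) := by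
  intro v hv
  rw [hV, hchart _ hv, sub_mul, Complex.sub_re, Complex.sub_im, (tp_mesh_frame K δ v).1,
    (tp_mesh_frame K δ v).2, sub_nonneg, sub_nonneg, Int.ceil_le, Int.ceil_le, div_le_iff₀ hδ,
    div_le_iff₀ hδ]
  constructor <;> rintro ⟨h1, h2⟩ <;> constructor <;> linarith

/-- **Reflex lattice chart**: `0 ≤ im u ∨ re u ≤ 0` becomes `⌈·⌉ ≤ ⟨v, dir (K+1)⟩ ∨
⟨v, dir K⟩ ≤ ⌊·⌋`. [folklore] -/
theorem tp_lattice_reflex {S : Set ℂ} {δ : ℝ} (hδ : 0 < δ) {V : Finset (ℤ × ℤ)}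
    (hV : ∀ v : ℤ × ℤ, v ∈ V ↔
      ((v.1 : ℂ) * ((δ : ℝ) : ℂ) + (v.2 : ℂ) * ((δ : ℝ) : ℂ) * Complex.I) ∈ S)
    (K : Fin 4) {q : ℂ} {R : ℝ}
    (hchart : ∀ w, dist w q < R → (w ∈ S ↔ 0 ≤ ((w - q) * (-Complex.I) ^ (K : ℕ)).im ∨
      ((w - q) * (-Complex.I) ^ (K : ℕ)).re ≤ 0)) :
    ∀ v : ℤ × ℤ, dist ((v.1 : ℂ) * ((δ : ℝ) : ℂ) + (v.2 : ℂ) * ((δ : ℝ) : ℂ) * Complex.I) q < R →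
      (v ∈ V ↔ ⌈(q * (-Complex.I) ^ (K : ℕ)).im / δ⌉ ≤ v.1 * (dir (K + 1)).1 + v.2 * (dir (K + 1)).2 ∨
        v.1 * (dir K).1 + v.2 * (dir K).2 ≤ ⌊(q * (-Complex.I) ^ (K : ℕ)).re / δ⌋) := by
  intro v hv
  rw [hV, hchart _ hv, sub_mul, Complex.sub_re, Complex.sub_im, (tp_mesh_frame K δ v).1,
    (tp_mesh_frame K δ v).2, sub_nonneg, sub_nonpos, Int.ceil_le, Int.le_floor, div_le_iff₀ hδ,
    le_div_iff₀ hδ]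
  constructor <;> rintro (h | h)
  · left; linarith
  · right; linarith
  · left; linarith
  · right; linarith

/-- **Registered sub-goal `s7_latticeFlat` of stub `stub_transportPaths`** (the flat lattice chart,
one-line form of `tp_lattice_flat`). [folklore] -/
theorem s7_latticeFlat : ∀ (S : Set ℂ) (δ : ℝ), 0 < δ → ∀ (V : Finset (ℤ × ℤ)), (∀ v : ℤ × ℤ, v ∈ V ↔ ((v.1 : ℂ) * ((δ : ℝ) : ℂ) + (v.2 : ℂ) * ((δ : ℝ) : ℂ) * Complex.I) ∈ S) → ∀ (K : Fin 4) (q : ℂ) (R : ℝ), (∀ w, dist w q < R → (w ∈ S ↔ 0 ≤ ((w - q) * (-Complex.I) ^ (K : ℕ)).im)) → ∀ v : ℤ × ℤ, dist ((v.1 : ℂ) * ((δ : ℝ) : ℂ) + (v.2 : ℂ) * ((δ : ℝ) : ℂ) * Complex.I) q < R → (v ∈ V ↔ ⌈(q * (-Complex.I) ^ (K : ℕ)).im / δ⌉ ≤ v.1 * (Literature.Probability.LatticeModels.CollarLegModel.dir (K + 1)).1 + v.2 * (Literature.Probability.LatticeModels.CollarLegModel.dir (K + 1)).2) :=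
  fun _ _ hδ _ hV K _ _ hchart => tp_lattice_flat hδ hV K hchart

end Summit.CriticalPhenomena.CardyFormulaZ2.Cruxes.BoundaryDefectGaussianR.RainbowMonomialsInExcursionKernels

end
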